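import Literature.MathematicalPhysics.QuantumFieldTheory.BalabanImbrieJaffe1984to88.BIJ88Sect5StatementsPart4

/-!
# `BalabanImbrieJaffe1984to88.BIJ88CrossTerm556` — T. Bałaban, J. Imbrie, A. Jaffe, *Effective action and cluster properties of
the abelian Higgs model*, Commun. Math. Phys. **114** (1988) 257–315 [BalabanImbrieJaffe1988], §5.5 *Second Gauge Field Translation*,
p. 284: the quadratic form `𝒬′₁` after the translation (5.5.2) — **(5.5.3)** —, the `f·A^{(k)}` cross term **(5.5.6)**, the kernel `w₃`
**(5.5.8)**, `𝒬₂ = 𝒬′₂ + 𝒬″₂` **(5.5.9)**, and the sentence *"then we have written the cross-term as 𝒬₂ + ⟨f, w₃A^{(k)}⟩"* — PROVED as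
inner-product ∕ operator algebra on the fold owner's carrier (`Module.End ℝ M`), knitting r16's typed (5.5.2) `transl552`, (5.5.4)
`eq554`/`wDoublePrime3` and (5.5.7) `eq557`/`wTriplePrime3`

statement-level skeleton of published theorems with citation tags; proofs where landed; nothing here is a claim about the Yang–Mills mass gap

PDF held: `paper:balaban1988-cmp114-bij-abelian-higgs-effective-action` (journal page = PDF page + 256).  Renders read this session as images:
pp. 283–285 = PDF 27–29 (`pages/original-p027-x2.png` … `-p029-x2.png` in the p02 gen-5 seat folder).

**What the paper prints (p. 284, verbatim).**  *"The quadratic form 𝒬′₁ becomes 𝒬′₁ = ½⟨Λ₁^{(k)**}∂A^{(k)}, σ_{k,loc}Λ₁^{(k)**}∂A^{(k)}⟩ +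
⟨Λ₁^{(k)**}L⁻²Q^{e*}f − ∂Λ₄^{(k)*}L⁻²C^{(k)}_{loc}H*_{k,loc}∂*Q^{e*}_{k+1}f, σ_{k,loc}Λ₁^{(k)**}∂A^{(k)}⟩ + ½L⁻⁴⟨Λ₁^{(k)**}Q^{e*}f −
∂Λ₄^{(k)*}C^{(k)}_{loc}H*_{k,loc}∂*Q^{e*}_{k+1}f, σ_{k,loc}(Λ₁^{(k)**}Q^{e*}f − ∂Λ₄^{(k)*}C^{(k)}_{loc}H*_{k,loc}∂*Q^{e*}_{k+1}f)⟩. (5.5.3)  In the second term we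
isolate a term localized near Λ₅^{(k)c} and a small term. We write 𝒬′₂ = ⟨Λ₁^{(k)**}L⁻²Q^{e*}f, σ_{k,loc}Λ₁^{(k)**}∂Λ₂^{(k)*c}A^{(k)}⟩, and in the
term with Λ₂^{(k)*} instead of Λ₂^{(k)*c} we put σ_{k,loc}∂Λ₂^{(k)*}A^{(k)} = … = Q^e_k∂^ηH_{k,loc}Λ₂^{(k)*}A^{(k)} + w″₃A^{(k)}. (5.5.4) … The f·A^{(k)}
cross-term is now 𝒬′₂ + ⟨Λ₁^{(k)**}L⁻²Q₁^{e*}f, w″₃A^{(k)}⟩ − ⟨f, Q^e_{k+1}∂^ηH_{k,loc}C^{(k)}_{loc}L⁻²Λ₄^{(k)*}∂*σ_{k,loc}∂A^{(k)}⟩ +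
⟨f, L⁻²Q^e_{k+1}∂^ηH_{k,loc}Λ₂^{(k)*}A^{(k)}⟩. (5.5.6)  We insert the decomposition f = Λ₅^{(k)′**}f + Λ₅^{(k)′**c}f in the last two terms. The
terms with Λ₅^{(k)′**c}f will be denoted by 𝒬″₂. The first Λ₅^{(k)′**} term involves C^{(k)}_{loc}∂*σ_{k,loc}∂ = I + w‴₃, (5.5.7) with another
small, short-ranged kernel w‴₃. The term with the identity operator cancels the second Λ₅^{(k)′**} term. Thus if we define ⟨f, w₃A^{(k)}⟩ =
⟨Λ₁^{(k)**}L⁻²Q₁^{e*}f, w″₃A^{(k)}⟩ − ⟨Λ₅^{(k)′**}L⁻²f, Q^e_{k+1}∂^ηH_{k,loc}w‴₃A^{(k)}⟩, (5.5.8)  𝒬₂ = 𝒬′₂ + 𝒬″₂, (5.5.9)  then we have written the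
cross-term as 𝒬₂ + ⟨f, w₃A^{(k)}⟩, with 𝒬₂ large but localized in a ½r(e_k)-neighborhood of Λ₅^{(k)c}, and with w₃ very small and having
a range ½r(e_k)."*

**What is reproduced here (kernel-checked, zero `sorry`, no named facts).**  ONE real inner-product space `M` of lattice fields and all
operators in `Module.End ℝ M` — the carrier on which the fold owner typed (5.5.2) `transl552`, (5.5.4) `eq554` and (5.5.7) `eq557`
(`BIJ88Sect5StatementsPart3`; rectangular typing suppressed there and here); the operator dictionary is the bundle `Ops` (fields
documented there), the printed-implicit facts are the laws `Ops.Laws`: symmetry of `σ_{k,loc}`, of the characteristic functions `Λ₁**,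
Λ₂*, Λ₄*, Λ₅′**` and of `C^{(k)}_{loc}`; the adjoint pairs `(∂, ∂*)`, `(Q^{e*}, Q^e)`, `(H*_{k,loc}∂*Q^{e*}_{k+1}, Q^e_{k+1}∂^ηH_{k,loc})`; the
composition `Q^e_{k+1}∂^ηH_{k,loc} = Q^e·(Q^e_k∂^ηH_{k,loc})`; r16's (5.5.4) inputs `Eq551`, the `□`-range statement; and six SUPPORT LAWS
the print uses silently when it drops characteristic functions between (5.5.3) and (5.5.8) (`Λ₁**∂Λ₄* = ∂Λ₄*`, `Λ₁**∂Λ₂* = ∂Λ₂*`,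
`Λ₁**Q^e_k∂^ηH_{k,loc}Λ₂* = Q^e_k∂^ηH_{k,loc}Λ₂*`, `Λ₄*∂*σ_{k,loc}Λ₁**∂ = Λ₄*∂*σ_{k,loc}∂`, `Λ₄*C_{loc}H*_{loc}∂*Q^{e*}_{k+1}Λ₅′** =
C_{loc}H*_{loc}∂*Q^{e*}_{k+1}Λ₅′**`, `Λ₂*H*_{loc}∂*Q^{e*}_{k+1}Λ₅′** = H*_{loc}∂*Q^{e*}_{k+1}Λ₅′**` — the regions are nested with collars wider than
the ranges of the localized kernels, (5.2.1)–(5.2.4)).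
* DEFINITIONS (bodies = the printed brackets): `Ops.S` (the shift of (5.5.2); `transl552_eq_sub`), `Ops.fk` (the inside part
  `∂A′ + L⁻²Q^{e*}f` of (5.3.2)), **`Ops.Q1'`** (`𝒬′₁ = ½⟨Λ₁**f^{(k)}, σ_{k,loc}Λ₁**f^{(k)}⟩` of (5.3.5)), `Ops.gf` (the printed slot
  `Λ₁**L⁻²Q^{e*}f − ∂Λ₄*L⁻²C_{loc}H*_{loc}∂*Q^{e*}_{k+1}f`), `Ops.crossTerm` (the middle term of (5.5.3)), **`Ops.Q2'`**, **`Ops.Q2''`**,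
  **`Ops.Q2`** (5.5.9), **`Ops.w3form`** (5.5.8), `Ops.w3''`/`Ops.w3'''` (= r16's `wDoublePrime3`/`wTriplePrime3`).
* **`Ops.eq553`** — (5.5.3); **`Ops.eq556`** — (5.5.6); **`Ops.crossTerm_eq`** — *"we have written the cross-term as 𝒬₂ + ⟨f, w₃A^{(k)}⟩"*;
  `Ops.Q2'_eq_zero`/`Ops.Q2''_eq_zero` (the localization forms vanish when `Λ₂* = I` resp. `Λ₅′** = I`).

**Readings (declared).**  (i) real Hilbert-space reading of `⟨·,·⟩`; (ii) `Q₁^{e*}` in (5.5.6)/(5.5.8) = the one-step `Q^{e*}` of (5.3.2)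
(print's subscript 1); (iii) the support laws listed above are hypotheses, not derived from (5.2.1)–(5.2.4) here.
**What is NOT claimed.**  The bounds (5.5.5) on `w′₃, w″₃`, the smallness/range of `w₃`, the localization of `𝒬₂` near `Λ₅^{(k)c}`, the
`f`-quadratic part ((5.5.10)–(5.5.12), a separate file); nothing of B1–B16; NOT summit progress; NOT continuum; NOT Clay.  Imports
`BIJ88Sect5StatementsPart4` (for Part 3's (5.5.x) and Mathlib); no Summits import; sub-namespace `…BIJ88CrossTerm556`; modifies nothing.
Cell `lit-balaban` Phase 2 (HOME `run/shared/lean/pub/lit-balaban/`), seat p02 gen 5 (`literature-prover-lit-balaban-p02-g5-0`); row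
**C2.Eq5.5.1-5.5.12** (owner r16, referee ref-5), members (5.5.3), (5.5.6), (5.5.8), (5.5.9) «absent» → proved/typed.
-/

open scoped RealInnerProductSpace
namespace Literature.MathematicalPhysics.QuantumFieldTheory.BalabanImbrieJaffe1984to88.BIJ88CrossTerm556
open BIJ88Sect5StatementsPart3
noncomputable section

variable {M : Type*} [NormedAddCommGroup M] [InnerProductSpace ℝ M]

variable (M) in
/-- The operator dictionary of §5.5 (pp. 283–284) on one space of lattice fields: `L` the block size; `σloc` = σ_{k,loc}, `σ` = σ_k;
`d`/`ds` = the unit-lattice ∂/∂*; `Λ1` = Λ₁^{(k)**}, `Λ2` = Λ₂^{(k)*}, `box` = the ½r(e_k)-cube `□` of (5.5.4), `Λ4` = Λ₄^{(k)*}, `Λ5` = Λ₅^{(k)′**}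
(characteristic functions); `Cloc` = C^{(k)}_{loc}; `Hsloc` = H*_{k,loc}; `X` = ∂*Q^{e*}_{k+1} (r16's letter); `Kst` = Q^e_{k+1}∂^ηH_{k,loc}
(the adjoint of `Hsloc·X`); `Qes` = the one-step Q^{e*} of (5.3.2) and `Qe1` its adjoint Q^e; `Qe` = Q^e_k, `dη` = ∂^η, `Hk` = H_k,
`Hloc` = H_{k,loc}` (the letters of r16's (5.5.4)). [cite: BalabanImbrieJaffe1988, (5.5.3) p.284] -/
structure Ops where
  (L : ℝ)
  (σloc σ d ds Λ1 Λ2 box Λ4 Λ5 Cloc Hsloc X Kst Qes Qe1 Qe dη Hk Hloc : Module.End ℝ M)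

namespace Ops

variable (O : Ops M)

/-- the shift of **(5.5.2)**: `A′ = A^{(k)} − Sf`, `S = L⁻²Λ₄*C^{(k)}_{loc}H*_{k,loc}∂*Q^{e*}_{k+1}`. [cite: BalabanImbrieJaffe1988, (5.5.2) p.283] -/
def S : Module.End ℝ M := O.L⁻¹ ^ 2 • (O.Λ4 * O.Cloc * O.Hsloc * O.X)

/-- r16's typed (5.5.2) `transl552 L Λ4 Cloc Hsloc X A f` is `A − Sf`. [cite: BalabanImbrieJaffe1988, (5.5.2) p.283] -/
theorem transl552_eq_sub (A f : M) : transl552 O.L O.Λ4 O.Cloc O.Hsloc O.X A f = A - O.S f := by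
  simp [transl552, S]

/-- the part of `f^{(k)}` inside `Λ₁^{(k)**}` after the first translation, **(5.3.2)**: `∂A′ + L⁻²Q^{e*}f`.
[cite: BalabanImbrieJaffe1988, (5.3.2) p.280] -/
def fk (A' f : M) : M := O.d A' + O.L⁻¹ ^ 2 • O.Qes f

/-- **`𝒬′₁`** of **(5.3.5)** p. 280: `𝒬′₁ = ½⟨Λ₁^{(k)**}(∂A′ + L⁻²Q^{e*}f), σ_{k,loc}Λ₁^{(k)**}(∂A′ + L⁻²Q^{e*}f)⟩`.
[cite: BalabanImbrieJaffe1988, (5.3.5) p.280] -/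
def Q1' (A' f : M) : ℝ := (1 / 2) * ⟪O.Λ1 (O.fk A' f), O.σloc (O.Λ1 (O.fk A' f))⟫

/-- the printed slot of (5.5.3): `Λ₁^{(k)**}L⁻²Q^{e*}f − ∂Λ₄^{(k)*}L⁻²C^{(k)}_{loc}H*_{k,loc}∂*Q^{e*}_{k+1}f = Λ₁**L⁻²Q^{e*}f − ∂Sf`.
[cite: BalabanImbrieJaffe1988, (5.5.3) p.284] -/
def gf (f : M) : M := O.Λ1 (O.L⁻¹ ^ 2 • O.Qes f) - O.d (O.S f)

/-- the middle term of (5.5.3), the `f·A^{(k)}` cross term: `⟨Λ₁**L⁻²Q^{e*}f − ∂Sf, σ_{k,loc}Λ₁**∂A^{(k)}⟩`.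
[cite: BalabanImbrieJaffe1988, (5.5.3) p.284] -/
def crossTerm (A f : M) : ℝ := ⟪O.gf f, O.σloc (O.Λ1 (O.d A))⟫

/-- `w″₃` of (5.5.4) = r16's `wDoublePrime3` on this dictionary. [cite: BalabanImbrieJaffe1988, (5.5.4) p.284] -/
def w3'' : Module.End ℝ M := wDoublePrime3 O.σloc O.σ O.d O.Λ2 O.box O.Qe O.dη O.Hk O.Hloc

/-- `w‴₃` of (5.5.7) = r16's `wTriplePrime3` on this dictionary. [cite: BalabanImbrieJaffe1988, (5.5.7) p.284] -/
def w3''' : Module.End ℝ M := wTriplePrime3 O.Cloc O.ds O.σloc O.d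

/-- **`𝒬′₂`** (p. 284): *"We write 𝒬′₂ = ⟨Λ₁^{(k)**}L⁻²Q^{e*}f, σ_{k,loc}Λ₁^{(k)**}∂Λ₂^{(k)*c}A^{(k)}⟩"* (`Λ₂*ᶜA = A − Λ₂*A`).
[cite: BalabanImbrieJaffe1988, (5.5.6) p.284] -/
def Q2' (A f : M) : ℝ := ⟪O.Λ1 (O.L⁻¹ ^ 2 • O.Qes f), O.σloc (O.Λ1 (O.d (A - O.Λ2 A)))⟫

/-- **`𝒬″₂`** (p. 284): *"We insert the decomposition f = Λ₅^{(k)′**}f + Λ₅^{(k)′**c}f in the last two terms [of (5.5.6)]. The terms with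
Λ₅^{(k)′**c}f will be denoted by 𝒬″₂"*. [cite: BalabanImbrieJaffe1988, (5.5.9) p.284] -/
def Q2'' (A f : M) : ℝ :=
  -⟪f - O.Λ5 f, O.L⁻¹ ^ 2 • O.Kst (O.Cloc (O.Λ4 (O.ds (O.σloc (O.d A)))))⟫ + ⟪f - O.Λ5 f, O.L⁻¹ ^ 2 • O.Kst (O.Λ2 A)⟫

/-- **(5.5.9)** p. 284, verbatim: *"𝒬₂ = 𝒬′₂ + 𝒬″₂, (5.5.9)"*. [cite: BalabanImbrieJaffe1988, (5.5.9) p.284] -/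
def Q2 (A f : M) : ℝ := O.Q2' A f + O.Q2'' A f

/-- **(5.5.8)** p. 284, verbatim: *"⟨f, w₃A^{(k)}⟩ = ⟨Λ₁^{(k)**}L⁻²Q₁^{e*}f, w″₃A^{(k)}⟩ − ⟨Λ₅^{(k)′**}L⁻²f, Q^e_{k+1}∂^ηH_{k,loc}w‴₃A^{(k)}⟩, (5.5.8)"*
(`Kst` = Q^e_{k+1}∂^ηH_{k,loc}). [cite: BalabanImbrieJaffe1988, (5.5.8) p.284] -/
def w3form (A f : M) : ℝ := ⟪O.Λ1 (O.L⁻¹ ^ 2 • O.Qes f), O.w3'' A⟫ - ⟪O.Λ5 (O.L⁻¹ ^ 2 • f), O.Kst (O.w3''' A)⟫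

/-- The printed-implicit facts used on p. 284 (see the module docstring): symmetries, adjoint pairs, the composition law for
`Q^e_{k+1}∂^ηH_{k,loc}`, r16's (5.5.4) inputs, and the six support laws of the nested regions. [cite: BalabanImbrieJaffe1988, (5.5.6) p.284] -/
structure Laws : Prop where
  σsym : ∀ x y : M, ⟪O.σloc x, y⟫ = ⟪x, O.σloc y⟫
  Λ1sym : ∀ x y : M, ⟪O.Λ1 x, y⟫ = ⟪x, O.Λ1 y⟫
  Λ2sym : ∀ x y : M, ⟪O.Λ2 x, y⟫ = ⟪x, O.Λ2 y⟫
  Λ4sym : ∀ x y : M, ⟪O.Λ4 x, y⟫ = ⟪x, O.Λ4 y⟫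
  Csym : ∀ x y : M, ⟪O.Cloc x, y⟫ = ⟪x, O.Cloc y⟫
  adjD : ∀ x y : M, ⟪O.d x, y⟫ = ⟪x, O.ds y⟫
  adjQ : ∀ x y : M, ⟪O.Qes x, y⟫ = ⟪x, O.Qe1 y⟫
  adjK : ∀ x y : M, ⟪O.Hsloc (O.X x), y⟫ = ⟪x, O.Kst y⟫
  hK : O.Kst = O.Qe1 * O.Qe * O.dη * O.Hloc
  h551 : Eq551 O.σ O.d O.Qe O.dη O.Hk
  hrange : O.σloc * O.d * O.Λ2 = O.σloc * O.d * O.Λ2 * O.box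
  hΛ14 : O.Λ1 * O.d * O.Λ4 = O.d * O.Λ4
  hΛ12 : O.Λ1 * O.d * O.Λ2 = O.d * O.Λ2
  hΛ1J : O.Λ1 * O.Qe * O.dη * O.Hloc * O.Λ2 = O.Qe * O.dη * O.Hloc * O.Λ2
  hΛ4σ : O.Λ4 * O.ds * O.σloc * O.Λ1 * O.d = O.Λ4 * O.ds * O.σloc * O.d
  hΛ45 : O.Λ4 * O.Cloc * O.Hsloc * O.X * O.Λ5 = O.Cloc * O.Hsloc * O.X * O.Λ5
  hΛ25 : O.Λ2 * O.Hsloc * O.X * O.Λ5 = O.Hsloc * O.X * O.Λ5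

/-! ## (5.5.3): the expansion of `𝒬′₁` under the second translation -/

/-- the first slot of `𝒬′₁` after (5.5.2): `Λ₁**f^{(k)} = Λ₁**∂A^{(k)} + (Λ₁**L⁻²Q^{e*}f − ∂Sf)` (support law `Λ₁**∂Λ₄* = ∂Λ₄*`).
[cite: BalabanImbrieJaffe1988, (5.5.3) p.284] -/
theorem Λ1_fk_transl (hΛ14 : O.Λ1 * O.d * O.Λ4 = O.d * O.Λ4) (A f : M) :
    O.Λ1 (O.fk (A - O.S f) f) = O.Λ1 (O.d A) + O.gf f := by
  have h1 : O.Λ1 (O.d (O.S f)) = O.d (O.S f) := by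
    have e := LinearMap.congr_fun hΛ14 (O.Cloc (O.Hsloc (O.X f)))
    simp only [Module.End.mul_apply] at e
    simp only [S, LinearMap.smul_apply, Module.End.mul_apply, map_smul, e]
  simp only [fk, gf, map_sub, map_add, h1]
  abel

/-- **(5.5.3)** p. 284 [PDF 28], verbatim: *"The quadratic form 𝒬′₁ becomes 𝒬′₁ = ½⟨Λ₁^{(k)**}∂A^{(k)}, σ_{k,loc}Λ₁^{(k)**}∂A^{(k)}⟩ +
⟨Λ₁^{(k)**}L⁻²Q^{e*}f − ∂Λ₄^{(k)*}L⁻²C^{(k)}_{loc}H*_{k,loc}∂*Q^{e*}_{k+1}f, σ_{k,loc}Λ₁^{(k)**}∂A^{(k)}⟩ + ½L⁻⁴⟨Λ₁^{(k)**}Q^{e*}f − ∂Λ₄^{(k)*}C^{(k)}_{loc}H*_{k,loc}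
∂*Q^{e*}_{k+1}f, σ_{k,loc}(Λ₁^{(k)**}Q^{e*}f − ∂Λ₄^{(k)*}C^{(k)}_{loc}H*_{k,loc}∂*Q^{e*}_{k+1}f)⟩. (5.5.3)"* — PROVED for `A′ = A^{(k)} − Sf` (5.5.2), with the
`L⁻²`'s kept inside the last slot (`½⟨g, σg⟩`, `g = L⁻²(…)`), given `σ_{k,loc}` symmetric and `Λ₁**∂Λ₄* = ∂Λ₄*`.
[cite: BalabanImbrieJaffe1988, (5.5.3) p.284] -/
theorem eq553 (hσ : ∀ x y : M, ⟪O.σloc x, y⟫ = ⟪x, O.σloc y⟫) (hΛ14 : O.Λ1 * O.d * O.Λ4 = O.d * O.Λ4) (A f : M) :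
    O.Q1' (A - O.S f) f =
      (1 / 2) * ⟪O.Λ1 (O.d A), O.σloc (O.Λ1 (O.d A))⟫ + O.crossTerm A f + (1 / 2) * ⟪O.gf f, O.σloc (O.gf f)⟫ := by
  have hs : ⟪O.Λ1 (O.d A), O.σloc (O.gf f)⟫ = ⟪O.gf f, O.σloc (O.Λ1 (O.d A))⟫ := by
    rw [real_inner_comm, hσ]
  simp only [Q1', crossTerm, O.Λ1_fk_transl hΛ14, map_add, inner_add_left, inner_add_right, hs]
  ring

/-- (5.5.3) for r16's typed translation `transl552`. [cite: BalabanImbrieJaffe1988, (5.5.3) p.284] -/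
theorem eq553_transl552 (hσ : ∀ x y : M, ⟪O.σloc x, y⟫ = ⟪x, O.σloc y⟫) (hΛ14 : O.Λ1 * O.d * O.Λ4 = O.d * O.Λ4) (A f : M) :
    O.Q1' (transl552 O.L O.Λ4 O.Cloc O.Hsloc O.X A f) f =
      (1 / 2) * ⟪O.Λ1 (O.d A), O.σloc (O.Λ1 (O.d A))⟫ + O.crossTerm A f + (1 / 2) * ⟪O.gf f, O.σloc (O.gf f)⟫ := by
  rw [O.transl552_eq_sub, O.eq553 hσ hΛ14]

/-! ## (5.5.6): the `f·A^{(k)}` cross term -/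

/-- **(5.5.6)** p. 284 [PDF 28], verbatim: *"The f·A^{(k)} cross-term is now 𝒬′₂ + ⟨Λ₁^{(k)**}L⁻²Q₁^{e*}f, w″₃A^{(k)}⟩ −
⟨f, Q^e_{k+1}∂^ηH_{k,loc}C^{(k)}_{loc}L⁻²Λ₄^{(k)*}∂*σ_{k,loc}∂A^{(k)}⟩ + ⟨f, L⁻²Q^e_{k+1}∂^ηH_{k,loc}Λ₂^{(k)*}A^{(k)}⟩. (5.5.6)"* — PROVED from (5.5.4)
(r16's `eq554`, `w″₃ = wDoublePrime3`), the adjoint pairs and the support laws of `Ops.Laws`. [cite: BalabanImbrieJaffe1988, (5.5.6) p.284] -/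
theorem eq556 (h : O.Laws) (A f : M) :
    O.crossTerm A f =
      O.Q2' A f + ⟪O.Λ1 (O.L⁻¹ ^ 2 • O.Qes f), O.w3'' A⟫
        - ⟪f, O.L⁻¹ ^ 2 • O.Kst (O.Cloc (O.Λ4 (O.ds (O.σloc (O.d A)))))⟫ + ⟪f, O.L⁻¹ ^ 2 • O.Kst (O.Λ2 A)⟫ := by
  have e12 : O.Λ1 (O.d (O.Λ2 A)) = O.d (O.Λ2 A) := by
    simpa only [Module.End.mul_apply] using LinearMap.congr_fun h.hΛ12 A
  have e1J : O.Λ1 (O.Qe (O.dη (O.Hloc (O.Λ2 A)))) = O.Qe (O.dη (O.Hloc (O.Λ2 A))) := by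
    simpa only [Module.End.mul_apply] using LinearMap.congr_fun h.hΛ1J A
  have eK : O.Kst (O.Λ2 A) = O.Qe1 (O.Qe (O.dη (O.Hloc (O.Λ2 A)))) := by
    simpa only [Module.End.mul_apply] using LinearMap.congr_fun h.hK (O.Λ2 A)
  have e4σ : O.Λ4 (O.ds (O.σloc (O.Λ1 (O.d A)))) = O.Λ4 (O.ds (O.σloc (O.d A))) := by
    simpa only [Module.End.mul_apply] using LinearMap.congr_fun h.hΛ4σ A
  have e554 : O.σloc (O.d (O.Λ2 A)) = O.Qe (O.dη (O.Hloc (O.Λ2 A))) + O.w3'' A := by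
    simpa only [Module.End.mul_apply, LinearMap.add_apply, w3''] using
      LinearMap.congr_fun (eq554 h.h551 h.hrange O.Hloc).2.2 A
  -- `σΛ₁**∂A = σΛ₁**∂Λ₂*ᶜA + σ∂Λ₂*A`
  have hA : O.σloc (O.Λ1 (O.d A)) = O.σloc (O.Λ1 (O.d (A - O.Λ2 A))) + O.σloc (O.d (O.Λ2 A)) := by
    rw [← map_add, map_sub, map_sub, e12, sub_add_cancel]
  -- the `Λ₂*` part of the first term: `⟨Λ₁**L⁻²Q^{e*}f, Q^e_k∂^ηH_{k,loc}Λ₂*A⟩ = ⟨f, L⁻²Q^e_{k+1}∂^ηH_{k,loc}Λ₂*A⟩`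
  have t1 : ⟪O.Λ1 (O.L⁻¹ ^ 2 • O.Qes f), O.Qe (O.dη (O.Hloc (O.Λ2 A)))⟫ = ⟪f, O.L⁻¹ ^ 2 • O.Kst (O.Λ2 A)⟫ := by
    rw [h.Λ1sym, e1J, real_inner_smul_left, h.adjQ, real_inner_smul_right, eK]
  -- the translation part: `⟨∂Sf, σΛ₁**∂A⟩ = ⟨f, L⁻²Q^e_{k+1}∂^ηH_{k,loc}C_{loc}Λ₄*∂*σ∂A⟩`
  have t2 : ⟪O.d (O.S f), O.σloc (O.Λ1 (O.d A))⟫ = ⟪f, O.L⁻¹ ^ 2 • O.Kst (O.Cloc (O.Λ4 (O.ds (O.σloc (O.d A)))))⟫ := by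
    rw [h.adjD, S, LinearMap.smul_apply]
    simp only [Module.End.mul_apply]
    rw [real_inner_smul_left, h.Λ4sym, e4σ, h.Csym, h.adjK, real_inner_smul_right]
  rw [crossTerm, gf, inner_sub_left, t2, hA, inner_add_right, e554, inner_add_right, t1, Q2']
  ring

/-! ## (5.5.7)–(5.5.9): "then we have written the cross-term as 𝒬₂ + ⟨f, w₃A^{(k)}⟩" -/

/-- dropping `Λ₄*` against `Λ₅′**f` (support law `Λ₄*C_{loc}H*_{loc}∂*Q^{e*}_{k+1}Λ₅′** = C_{loc}H*_{loc}∂*Q^{e*}_{k+1}Λ₅′**`):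
`⟨Λ₅′**f, Q^e_{k+1}∂^ηH_{loc}C_{loc}Λ₄*Y⟩ = ⟨Λ₅′**f, Q^e_{k+1}∂^ηH_{loc}C_{loc}Y⟩`. [cite: BalabanImbrieJaffe1988, (5.5.7) p.284] -/
theorem inner_Λ5_Kst_Cloc_Λ4 (h : O.Laws) (f Y : M) :
    ⟪O.Λ5 f, O.Kst (O.Cloc (O.Λ4 Y))⟫ = ⟪O.Λ5 f, O.Kst (O.Cloc Y)⟫ := by
  have e45 : O.Λ4 (O.Cloc (O.Hsloc (O.X (O.Λ5 f)))) = O.Cloc (O.Hsloc (O.X (O.Λ5 f))) := by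
    simpa only [Module.End.mul_apply] using LinearMap.congr_fun h.hΛ45 f
  rw [← h.adjK, ← h.Csym, ← h.Λ4sym, e45, h.Csym, h.adjK]

/-- *"The term with the identity operator cancels the second Λ₅^{(k)′**} term"* (support law `Λ₂*H*_{loc}∂*Q^{e*}_{k+1}Λ₅′** =
H*_{loc}∂*Q^{e*}_{k+1}Λ₅′**`): `⟨Λ₅′**f, Q^e_{k+1}∂^ηH_{loc}Λ₂*A⟩ = ⟨Λ₅′**f, Q^e_{k+1}∂^ηH_{loc}A⟩`. [cite: BalabanImbrieJaffe1988, (5.5.7) p.284] -/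
theorem inner_Λ5_Kst_Λ2 (h : O.Laws) (f A : M) : ⟪O.Λ5 f, O.Kst (O.Λ2 A)⟫ = ⟪O.Λ5 f, O.Kst A⟫ := by
  have e25 : O.Λ2 (O.Hsloc (O.X (O.Λ5 f))) = O.Hsloc (O.X (O.Λ5 f)) := by
    simpa only [Module.End.mul_apply] using LinearMap.congr_fun h.hΛ25 f
  rw [← h.adjK, ← h.Λ2sym, e25, h.adjK]

/-- (5.5.7) pointwise on this dictionary (r16's `eq557`): `C_{loc}∂*σ_{k,loc}∂A = A + w‴₃A`. [cite: BalabanImbrieJaffe1988, (5.5.7) p.284] -/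
theorem eq557_apply (A : M) : O.Cloc (O.ds (O.σloc (O.d A))) = A + O.w3''' A := by
  simpa only [Module.End.mul_apply, LinearMap.add_apply, Module.End.one_apply, w3'''] using
    LinearMap.congr_fun (eq557 O.Cloc O.ds O.σloc O.d) A

/-- p. 284 [PDF 28], the conclusion of §5.5 for the cross term, verbatim: *"Thus if we define ⟨f, w₃A^{(k)}⟩ = … (5.5.8), 𝒬₂ = 𝒬′₂ + 𝒬″₂,
(5.5.9) then we have written the cross-term as 𝒬₂ + ⟨f, w₃A^{(k)}⟩"* — PROVED from (5.5.6), the decomposition `f = Λ₅′**f + Λ₅′**ᶜf`,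
(5.5.7) (r16's `eq557`) and the support laws. [cite: BalabanImbrieJaffe1988, (5.5.9) p.284] -/
theorem crossTerm_eq (h : O.Laws) (A f : M) : O.crossTerm A f = O.Q2 A f + O.w3form A f := by
  have split : ∀ v : M, ⟪f, v⟫ = ⟪O.Λ5 f, v⟫ + ⟪f - O.Λ5 f, v⟫ := fun v => by
    rw [← inner_add_left, add_sub_cancel]
  rw [O.eq556 h, split (O.L⁻¹ ^ 2 • O.Kst (O.Cloc (O.Λ4 (O.ds (O.σloc (O.d A)))))), split (O.L⁻¹ ^ 2 • O.Kst (O.Λ2 A))]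
  have p3 : ⟪O.Λ5 f, O.L⁻¹ ^ 2 • O.Kst (O.Cloc (O.Λ4 (O.ds (O.σloc (O.d A)))))⟫
      = O.L⁻¹ ^ 2 * ⟪O.Λ5 f, O.Kst A⟫ + O.L⁻¹ ^ 2 * ⟪O.Λ5 f, O.Kst (O.w3''' A)⟫ := by
    rw [real_inner_smul_right, O.inner_Λ5_Kst_Cloc_Λ4 h, O.eq557_apply, map_add, inner_add_right, mul_add]
  have p4 : ⟪O.Λ5 f, O.L⁻¹ ^ 2 • O.Kst (O.Λ2 A)⟫ = O.L⁻¹ ^ 2 * ⟪O.Λ5 f, O.Kst A⟫ := by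
    rw [real_inner_smul_right, O.inner_Λ5_Kst_Λ2 h]
  have p5 : ⟪O.Λ5 (O.L⁻¹ ^ 2 • f), O.Kst (O.w3''' A)⟫ = O.L⁻¹ ^ 2 * ⟪O.Λ5 f, O.Kst (O.w3''' A)⟫ := by
    rw [map_smul, real_inner_smul_left]
  rw [p3, p4, Q2, Q2'', w3form, p5]
  ring

/-- `𝒬′₂` vanishes when there is no localization `Λ₂^{(k)*}` (`Λ₂* = I`). [cite: BalabanImbrieJaffe1988, (5.5.6) p.284] -/
theorem Q2'_eq_zero (h2 : O.Λ2 = 1) (A f : M) : O.Q2' A f = 0 := by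
  simp [Q2', h2]

/-- `𝒬″₂` vanishes when there is no localization `Λ₅^{(k)′**}` (`Λ₅′** = I`). [cite: BalabanImbrieJaffe1988, (5.5.9) p.284] -/
theorem Q2''_eq_zero (h5 : O.Λ5 = 1) (A f : M) : O.Q2'' A f = 0 := by
  simp [Q2'', h5]

end Ops

end

end Literature.MathematicalPhysics.QuantumFieldTheory.BalabanImbrieJaffe1984to88.BIJ88CrossTerm556
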